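import Summits.CriticalPhenomena.PercolationContinuityZ3.Theorems.PercNearOneGluingNoHeavyLowerTailAntitheticApexConeInvariance
import HarnessLib

/-!
# `NoHeavyLowerTail` (stmt-CriticalPhenomena-4575) — antithetic cluster pairs: the zone system of THEOREM U (a UNIVERSAL vertex `k₀ ≠ s` and
# `N(s)` a clique; every avoidance set `R`) — part 1: definitions, swap, facts about unreached vertices, boundary (prim-hp-2 gen 37;
# HOME/THEOREM-U-universal.md, MEMO-gen37 §4e)

Support file (`--supports stmt-CriticalPhenomena-4575`, hull-port prover `prim-hp-2`, gen 37).  No named facts, no sorries; standard axioms.  The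
`def`s `Antithetic.UCone.{hub, own, swSet, zone, beta}` are proof-internal bookkeeping of THEOREM U.

CLASS U: `k₀ ≠ s` is adjacent to every other vertex (`huniv`) and the neighbours of `s` are pairwise adjacent (`hclq`).  Colourings `T`
(`T ∩ E` red, `Tᶜ ∩ E` blue); `c₀` = the colour of the spoke `s k₀`.  FACTS for a vertex `x` reached in neither colour (`UCone.opp_spoke`,
`hub_not_reached`, `kedge_iff`, `own_unreached`): `x k₀` has colour `c̄₀`, so `k₀` is not `c̄₀`-reached; every edge from `x` to `N(s)` has colour
`c̄₀` (clique); the `c̄₀`-cluster of `x` is the `c̄₀`-cluster `hub` of `k₀`; the `c₀`-cluster `own x` of `x` is entirely unreached.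
ZONE SYSTEM: red-reached `r`: blue cluster, colour red; blue-reached: red cluster, blue; unreached `r`: if `hub` contains a reached vertex of
`R` ("swallowed", `T ∈ swSet` — one predicate for all unreached `r`) then `zone = hub`, colour `c₀`, else `zone = own r`, colour `c̄₀`.
Census of all zone-system obligations with the canonical top: HOME/code/gen37/lab37/classL.py, all class-U graphs with `n ≤ 6`, all `R`: 5 536
instances, 0 failures.
[cite: VandenbergHaggstromKahn2005, §1 p. 3 (open cluster `C_s`)]
-/

noncomputable section

namespace Summit.CriticalPhenomena.PercolationContinuityZ3.Theorems

open Literature.Probability.Percolation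
open scoped Classical symmDiff

namespace Antithetic

namespace UCone

variable {V : Type*}

/-- The HUB cluster: the cluster of `k₀` in the colour opposite to its spoke `s k₀`. [this work] -/
def hub (E : Set (Sym2 V)) (s k₀ : V) (T : Set (Sym2 V)) : Set V :=
  {v | (s(s, k₀) ∈ T ∧ v ∈ openCluster (Tᶜ ∩ E) k₀) ∨ (s(s, k₀) ∉ T ∧ v ∈ openCluster (T ∩ E) k₀)}

/-- The OWN cluster of `r`: the cluster of `r` in the colour of the spoke `s k₀`. [this work] -/
def own (E : Set (Sym2 V)) (s k₀ : V) (T : Set (Sym2 V)) (r : V) : Set V :=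
  {v | (s(s, k₀) ∈ T ∧ v ∈ openCluster (T ∩ E) r) ∨ (s(s, k₀) ∉ T ∧ v ∈ openCluster (Tᶜ ∩ E) r)}

/-- The SWALLOWING colourings: those in which the hub cluster contains a vertex of `R` reached from `s`. [this work] -/
def swSet (E : Set (Sym2 V)) (s k₀ : V) (R : Set V) : Set (Set (Sym2 V)) :=
  {T | ∃ q ∈ R, ((openGraph (T ∩ E)).Reachable s q ∨ (openGraph (Tᶜ ∩ E)).Reachable s q) ∧ q ∈ hub E s k₀ T}

/-- The ZONE of `r` (module docstring). [this work] -/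
def zone (E : Set (Sym2 V)) (s k₀ : V) (R : Set V) (T : Set (Sym2 V)) (r : V) : Set V :=
  {v | v = r ∨ ((openGraph (T ∩ E)).Reachable s r ∧ v ∈ openCluster (Tᶜ ∩ E) r) ∨
    ((openGraph (Tᶜ ∩ E)).Reachable s r ∧ v ∈ openCluster (T ∩ E) r) ∨
    (¬ (openGraph (T ∩ E)).Reachable s r ∧ ¬ (openGraph (Tᶜ ∩ E)).Reachable s r ∧ T ∈ swSet E s k₀ R ∧ v ∈ hub E s k₀ T) ∨
    (¬ (openGraph (T ∩ E)).Reachable s r ∧ ¬ (openGraph (Tᶜ ∩ E)).Reachable s r ∧ T ∉ swSet E s k₀ R ∧ v ∈ own E s k₀ T r)}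

/-- The RED ZONES: `r ∈ beta` iff the zone of `r` has colour red (module docstring). [this work] -/
def beta (E : Set (Sym2 V)) (s k₀ : V) (R : Set V) (T : Set (Sym2 V)) : Set V :=
  {r | (openGraph (T ∩ E)).Reachable s r ∨ (¬ (openGraph (T ∩ E)).Reachable s r ∧ ¬ (openGraph (Tᶜ ∩ E)).Reachable s r ∧
    (T ∈ swSet E s k₀ R ↔ s(s, k₀) ∈ T))}

section Swap

variable (E : Set (Sym2 V)) (s k₀ : V) (R : Set V) (T : Set (Sym2 V)) (r : V)

/-- The hub is swap-invariant. [this work] -/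
theorem hub_compl : hub E s k₀ Tᶜ = hub E s k₀ T := by
  ext v; simp only [hub, Set.mem_setOf_eq, compl_compl, Set.mem_compl_iff]; tauto

/-- The own cluster is swap-invariant. [this work] -/
theorem own_compl : own E s k₀ Tᶜ r = own E s k₀ T r := by
  ext v; simp only [own, Set.mem_setOf_eq, compl_compl, Set.mem_compl_iff]; tauto

/-- Swallowing is swap-invariant. [this work] -/
theorem sw_compl : Tᶜ ∈ swSet E s k₀ R ↔ T ∈ swSet E s k₀ R := by
  simp only [swSet, Set.mem_setOf_eq, compl_compl, hub_compl]
  exact exists_congr fun q => and_congr_right fun _ => and_congr_left fun _ => or_comm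

/-- Zones are swap-invariant. [this work] -/
theorem zone_compl : zone E s k₀ R Tᶜ r = zone E s k₀ R T r := by
  ext v; simp only [zone, Set.mem_setOf_eq, compl_compl, sw_compl, hub_compl, own_compl]; tauto

variable {E s k₀ R T r}

/-- The zone colour flips under the swap (for `r` not doubly reached). [this work] -/
theorem beta_compl (hD : ¬ ((openGraph (T ∩ E)).Reachable s r ∧ (openGraph (Tᶜ ∩ E)).Reachable s r)) :
    r ∈ beta E s k₀ R Tᶜ ↔ r ∉ beta E s k₀ R T := by
  simp only [beta, Set.mem_setOf_eq, compl_compl, sw_compl, Set.mem_compl_iff]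
  tauto

end Swap

section Facts

variable {E : Set (Sym2 V)} {s k₀ : V} {R : Set V} {T : Set (Sym2 V)} {x : V}

/-- `k₀` is reached in the colour of its spoke. [folklore] -/
theorem hubv_reached (hk : k₀ ≠ s) (huniv : ∀ v, v ≠ k₀ → s(k₀, v) ∈ E) :
    (s(s, k₀) ∈ T → (openGraph (T ∩ E)).Reachable s k₀) ∧ (s(s, k₀) ∉ T → (openGraph (Tᶜ ∩ E)).Reachable s k₀) := by
  have hsk : s(s, k₀) ∈ E := by rw [Sym2.eq_swap]; exact huniv s hk.symm
  exact ⟨fun h => ((openGraph_adj (T ∩ E) s k₀).2 ⟨⟨h, hsk⟩, hk.symm⟩).reachable,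
    fun h => ((openGraph_adj (Tᶜ ∩ E) s k₀).2 ⟨⟨h, hsk⟩, hk.symm⟩).reachable⟩

/-- **(a)** An unreached vertex `x` differs from `k₀` and its edge to `k₀` has the colour opposite to the spoke `s k₀`. [this work] -/
theorem opp_spoke (hk : k₀ ≠ s) (huniv : ∀ v, v ≠ k₀ → s(k₀, v) ∈ E)
    (hr : ¬ (openGraph (T ∩ E)).Reachable s x) (hb : ¬ (openGraph (Tᶜ ∩ E)).Reachable s x) :
    x ≠ k₀ ∧ s(x, k₀) ∈ E ∧ (s(x, k₀) ∈ T ↔ s(s, k₀) ∉ T) := by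
  obtain ⟨h1, h2⟩ := hubv_reached (T := T) hk huniv
  have hxk : x ≠ k₀ := by
    rintro rfl
    by_cases h : s(s, x) ∈ T
    · exact hr (h1 h)
    · exact hb (h2 h)
  have hE : s(x, k₀) ∈ E := by rw [Sym2.eq_swap]; exact huniv x hxk
  refine ⟨hxk, hE, ⟨fun hxT hsT => hr ((h1 hsT).trans ((openGraph_adj (T ∩ E) k₀ x).2
      ⟨⟨by rw [Sym2.eq_swap]; exact hxT, by rw [Sym2.eq_swap]; exact hE⟩, hxk.symm⟩).reachable), fun hsT => ?_⟩⟩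
  by_contra hxT
  exact hb ((h2 hsT).trans ((openGraph_adj (Tᶜ ∩ E) k₀ x).2
    ⟨⟨by rw [Sym2.eq_swap]; exact hxT, by rw [Sym2.eq_swap]; exact hE⟩, hxk.symm⟩).reachable)

/-- **(a')** If some vertex is unreached then `k₀` is not reached in the colour opposite to its spoke. [this work] -/
theorem hub_not_reached (hk : k₀ ≠ s) (huniv : ∀ v, v ≠ k₀ → s(k₀, v) ∈ E)
    (hr : ¬ (openGraph (T ∩ E)).Reachable s x) (hb : ¬ (openGraph (Tᶜ ∩ E)).Reachable s x) :
    (s(s, k₀) ∈ T → ¬ (openGraph (Tᶜ ∩ E)).Reachable s k₀) ∧ (s(s, k₀) ∉ T → ¬ (openGraph (T ∩ E)).Reachable s k₀) := by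
  obtain ⟨hxk, hE, hiff⟩ := opp_spoke hk huniv hr hb
  refine ⟨fun hsT hk₀ => hb (hk₀.trans ((openGraph_adj (Tᶜ ∩ E) k₀ x).2 ⟨⟨?_, ?_⟩, hxk.symm⟩).reachable),
    fun hsT hk₀ => hr (hk₀.trans ((openGraph_adj (T ∩ E) k₀ x).2 ⟨⟨?_, ?_⟩, hxk.symm⟩).reachable)⟩
  · rw [Sym2.eq_swap]; exact fun h => (hiff.1 h) hsT
  · rw [Sym2.eq_swap]; exact hE
  · rw [Sym2.eq_swap]; exact hiff.2 hsT
  · rw [Sym2.eq_swap]; exact hE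

/-- **(b)** Every edge from an unreached `x` to a neighbour `k` of `s` has the colour opposite to the spoke `s k₀` (the neighbours of `s` being
pairwise adjacent). [this work] -/
theorem kedge_iff (hk : k₀ ≠ s) (huniv : ∀ v, v ≠ k₀ → s(k₀, v) ∈ E)
    (hclq : ∀ u v, s(s, u) ∈ E → s(s, v) ∈ E → u ≠ s → v ≠ s → u ≠ v → s(u, v) ∈ E)
    (hr : ¬ (openGraph (T ∩ E)).Reachable s x) (hb : ¬ (openGraph (Tᶜ ∩ E)).Reachable s x)
    {k : V} (hsk : s(s, k) ∈ E) (hxk : s(x, k) ∈ E) (hkx : k ≠ x) : (s(x, k) ∈ T ↔ s(s, k₀) ∉ T) := by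
  obtain ⟨-, -, hiff⟩ := opp_spoke hk huniv hr hb
  obtain ⟨hn1, hn2⟩ := hub_not_reached hk huniv hr hb
  obtain ⟨h1, h2⟩ := hubv_reached (T := T) hk huniv
  have hsk₀ : s(s, k₀) ∈ E := by rw [Sym2.eq_swap]; exact huniv s hk.symm
  have hks : k ≠ s := by
    rintro rfl
    exact (reached_of_spoke E T (by rw [Sym2.eq_swap]; exact hxk) (ACone.ne_source_of_unreached hr)).elim hr hb
  by_cases hkk : k = k₀
  · subst hkk; exact hiff
  have hkk₀ : s(k, k₀) ∈ E := hclq k k₀ hsk hsk₀ hks hk hkk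
  -- `k` is not reached in the colour of the edge `x k`
  have hk_nr : s(x, k) ∈ T → ¬ (openGraph (T ∩ E)).Reachable s k := fun hT h =>
    hr (h.trans ((openGraph_adj (T ∩ E) k x).2 ⟨⟨by rw [Sym2.eq_swap]; exact hT, by rw [Sym2.eq_swap]; exact hxk⟩, hkx⟩).reachable)
  have hk_nb : s(x, k) ∉ T → ¬ (openGraph (Tᶜ ∩ E)).Reachable s k := fun hT h =>
    hb (h.trans ((openGraph_adj (Tᶜ ∩ E) k x).2 ⟨⟨by rw [Sym2.eq_swap]; exact hT, by rw [Sym2.eq_swap]; exact hxk⟩, hkx⟩).reachable)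
  constructor
  · intro hxT hsT
    have hknr := hk_nr hxT
    have hskT : s(s, k) ∉ T := fun h => hknr ((openGraph_adj (T ∩ E) s k).2 ⟨⟨h, hsk⟩, hks.symm⟩).reachable
    have hkb : (openGraph (Tᶜ ∩ E)).Reachable s k := ((openGraph_adj (Tᶜ ∩ E) s k).2 ⟨⟨hskT, hsk⟩, hks.symm⟩).reachable
    by_cases hkkT : s(k, k₀) ∈ T
    · exact hknr ((h1 hsT).trans ((openGraph_adj (T ∩ E) k₀ k).2
        ⟨⟨by rw [Sym2.eq_swap]; exact hkkT, by rw [Sym2.eq_swap]; exact hkk₀⟩, fun h => hkk h.symm⟩).reachable)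
    · exact hn1 hsT (hkb.trans ((openGraph_adj (Tᶜ ∩ E) k k₀).2 ⟨⟨hkkT, hkk₀⟩, hkk⟩).reachable)
  · intro hsT
    by_contra hxT
    have hknb := hk_nb hxT
    have hskT : s(s, k) ∈ T := by
      by_contra h
      exact hknb ((openGraph_adj (Tᶜ ∩ E) s k).2 ⟨⟨h, hsk⟩, hks.symm⟩).reachable
    have hkr : (openGraph (T ∩ E)).Reachable s k := ((openGraph_adj (T ∩ E) s k).2 ⟨⟨hskT, hsk⟩, hks.symm⟩).reachable
    by_cases hkkT : s(k, k₀) ∈ T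
    · exact hn2 hsT (hkr.trans ((openGraph_adj (T ∩ E) k k₀).2 ⟨⟨hkkT, hkk₀⟩, hkk⟩).reachable)
    · exact hknb ((h2 hsT).trans ((openGraph_adj (Tᶜ ∩ E) k₀ k).2
        ⟨⟨by rw [Sym2.eq_swap]; exact hkkT, by rw [Sym2.eq_swap]; exact hkk₀⟩, fun h => hkk h.symm⟩).reachable)

/-- Normal form of the hub when the spoke `s k₀` is red. [this work] -/
theorem hub_of_red (hsT : s(s, k₀) ∈ T) : hub E s k₀ T = openCluster (Tᶜ ∩ E) k₀ := by
  ext v; simp only [hub, Set.mem_setOf_eq, hsT, true_and, not_true_eq_false, false_and, or_false]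

/-- Normal form of the hub when the spoke `s k₀` is blue. [this work] -/
theorem hub_of_blue (hsT : s(s, k₀) ∉ T) : hub E s k₀ T = openCluster (T ∩ E) k₀ := by
  ext v; simp only [hub, Set.mem_setOf_eq, hsT, false_and, not_false_eq_true, true_and, false_or]

/-- Normal form of the own cluster when the spoke `s k₀` is red. [this work] -/
theorem own_of_red {r : V} (hsT : s(s, k₀) ∈ T) : own E s k₀ T r = openCluster (T ∩ E) r := by
  ext v; simp only [own, Set.mem_setOf_eq, hsT, true_and, not_true_eq_false, false_and, or_false]

/-- Normal form of the own cluster when the spoke `s k₀` is blue. [this work] -/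
theorem own_of_blue {r : V} (hsT : s(s, k₀) ∉ T) : own E s k₀ T r = openCluster (Tᶜ ∩ E) r := by
  ext v; simp only [own, Set.mem_setOf_eq, hsT, false_and, not_false_eq_true, true_and, false_or]

/-- `r` lies in its own cluster. [this work] -/
theorem mem_own_self {r : V} : r ∈ own E s k₀ T r := by
  by_cases hsT : s(s, k₀) ∈ T
  · rw [own_of_red hsT]; exact mem_openCluster_self _ _
  · rw [own_of_blue hsT]; exact mem_openCluster_self _ _

/-- **(c)** An unreached vertex lies in the hub. [this work] -/
theorem mem_hub (hk : k₀ ≠ s) (huniv : ∀ v, v ≠ k₀ → s(k₀, v) ∈ E)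
    (hr : ¬ (openGraph (T ∩ E)).Reachable s x) (hb : ¬ (openGraph (Tᶜ ∩ E)).Reachable s x) : x ∈ hub E s k₀ T := by
  obtain ⟨hxk, hE, hiff⟩ := opp_spoke hk huniv hr hb
  by_cases hsT : s(s, k₀) ∈ T
  · rw [hub_of_red hsT]
    exact ((openGraph_adj (Tᶜ ∩ E) k₀ x).2 ⟨⟨by rw [Sym2.eq_swap]; exact fun h => (hiff.1 h) hsT,
      by rw [Sym2.eq_swap]; exact hE⟩, hxk.symm⟩).reachable
  · rw [hub_of_blue hsT]
    exact ((openGraph_adj (T ∩ E) k₀ x).2 ⟨⟨by rw [Sym2.eq_swap]; exact hiff.2 hsT, by rw [Sym2.eq_swap]; exact hE⟩, hxk.symm⟩).reachable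

/-- **(d)** The own cluster of an unreached vertex consists of unreached vertices. [this work] -/
theorem own_unreached (hk : k₀ ≠ s) (huniv : ∀ v, v ≠ k₀ → s(k₀, v) ∈ E)
    (hr : ¬ (openGraph (T ∩ E)).Reachable s x) (hb : ¬ (openGraph (Tᶜ ∩ E)).Reachable s x)
    {v : V} (hv : v ∈ own E s k₀ T x) : ¬ (openGraph (T ∩ E)).Reachable s v ∧ ¬ (openGraph (Tᶜ ∩ E)).Reachable s v := by
  obtain ⟨hn1, hn2⟩ := hub_not_reached hk huniv hr hb
  obtain ⟨h1, h2⟩ := hubv_reached (T := T) hk huniv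
  by_cases hsT : s(s, k₀) ∈ T
  · rw [own_of_red hsT] at hv
    have hvr : ¬ (openGraph (T ∩ E)).Reachable s v := not_reachable_of_mem_openCluster _ hv hr
    refine ⟨hvr, fun hvb => ?_⟩
    have hvk : v ≠ k₀ := by
      rintro rfl
      exact hn1 hsT hvb
    have hE : s(k₀, v) ∈ E := huniv v hvk
    by_cases hT : s(k₀, v) ∈ T
    · exact hvr ((h1 hsT).trans ((openGraph_adj (T ∩ E) k₀ v).2 ⟨⟨hT, hE⟩, hvk.symm⟩).reachable)
    · exact hn1 hsT (hvb.trans ((openGraph_adj (Tᶜ ∩ E) v k₀).2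
        ⟨⟨by rw [Sym2.eq_swap]; exact hT, by rw [Sym2.eq_swap]; exact hE⟩, hvk⟩).reachable)
  · rw [own_of_blue hsT] at hv
    have hvb : ¬ (openGraph (Tᶜ ∩ E)).Reachable s v := not_reachable_of_mem_openCluster _ hv hb
    refine ⟨fun hvr => ?_, hvb⟩
    have hvk : v ≠ k₀ := by
      rintro rfl
      exact hn2 hsT hvr
    have hE : s(k₀, v) ∈ E := huniv v hvk
    by_cases hT : s(k₀, v) ∈ T
    · exact hn2 hsT (hvr.trans ((openGraph_adj (T ∩ E) v k₀).2
        ⟨⟨by rw [Sym2.eq_swap]; exact hT, by rw [Sym2.eq_swap]; exact hE⟩, hvk⟩).reachable)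
    · exact hvb ((h2 hsT).trans ((openGraph_adj (Tᶜ ∩ E) k₀ v).2 ⟨⟨hT, hE⟩, hvk.symm⟩).reachable)

end Facts

section NormalForms

variable {E : Set (Sym2 V)} {s k₀ : V} {R : Set V} {T : Set (Sym2 V)} {r : V}

/-- `r` lies in its zone. [this work] -/
theorem mem_zone_self : r ∈ zone E s k₀ R T r := Or.inl rfl

/-- Zone of a red-reached vertex. [this work] -/
theorem zone_of_red (hD : ¬ ((openGraph (T ∩ E)).Reachable s r ∧ (openGraph (Tᶜ ∩ E)).Reachable s r))
    (hr : (openGraph (T ∩ E)).Reachable s r) : zone E s k₀ R T r = openCluster (Tᶜ ∩ E) r := by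
  have hb : ¬ (openGraph (Tᶜ ∩ E)).Reachable s r := fun h => hD ⟨hr, h⟩
  ext v
  constructor
  · rintro (rfl | ⟨-, h⟩ | ⟨h, -⟩ | ⟨h, -⟩ | ⟨h, -⟩)
    · exact mem_openCluster_self _ _
    · exact h
    · exact absurd h hb
    · exact absurd hr h
    · exact absurd hr h
  · exact fun h => Or.inr (Or.inl ⟨hr, h⟩)

/-- Zone of a blue-reached vertex. [this work] -/
theorem zone_of_blue (hD : ¬ ((openGraph (T ∩ E)).Reachable s r ∧ (openGraph (Tᶜ ∩ E)).Reachable s r))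
    (hb : (openGraph (Tᶜ ∩ E)).Reachable s r) : zone E s k₀ R T r = openCluster (T ∩ E) r := by
  rw [← zone_compl]
  have := zone_of_red (E := E) (k₀ := k₀) (R := R) (T := Tᶜ) (r := r) (s := s) (by rw [compl_compl]; exact fun h => hD ⟨h.2, h.1⟩) hb
  rw [compl_compl] at this
  exact this

/-- Zone of a swallowed unreached vertex: the hub. [this work] -/
theorem zone_of_sw (hk : k₀ ≠ s) (huniv : ∀ v, v ≠ k₀ → s(k₀, v) ∈ E)
    (hr : ¬ (openGraph (T ∩ E)).Reachable s r) (hb : ¬ (openGraph (Tᶜ ∩ E)).Reachable s r)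
    (hsw : T ∈ swSet E s k₀ R) : zone E s k₀ R T r = hub E s k₀ T := by
  ext v
  constructor
  · rintro (rfl | ⟨h, -⟩ | ⟨h, -⟩ | ⟨-, -, -, h⟩ | ⟨-, -, h, -⟩)
    · exact mem_hub hk huniv hr hb
    · exact absurd h hr
    · exact absurd h hb
    · exact h
    · exact absurd hsw h
  · exact fun h => Or.inr (Or.inr (Or.inr (Or.inl ⟨hr, hb, hsw, h⟩)))

/-- Zone of a non-swallowed unreached vertex: its own cluster. [this work] -/
theorem zone_of_small (hr : ¬ (openGraph (T ∩ E)).Reachable s r) (hb : ¬ (openGraph (Tᶜ ∩ E)).Reachable s r)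
    (hsw : T ∉ swSet E s k₀ R) : zone E s k₀ R T r = own E s k₀ T r := by
  ext v
  constructor
  · rintro (rfl | ⟨h, -⟩ | ⟨h, -⟩ | ⟨-, -, h, -⟩ | ⟨-, -, -, h⟩)
    · exact mem_own_self
    · exact absurd h hr
    · exact absurd h hb
    · exact absurd h hsw
    · exact h
  · exact fun h => Or.inr (Or.inr (Or.inr (Or.inr ⟨hr, hb, hsw, h⟩)))

/-- Colour of a red-reached vertex. [this work] -/
theorem beta_of_red (hr : (openGraph (T ∩ E)).Reachable s r) : r ∈ beta E s k₀ R T := Or.inl hr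

/-- Colour of a blue-reached vertex. [this work] -/
theorem not_beta_of_blue (hD : ¬ ((openGraph (T ∩ E)).Reachable s r ∧ (openGraph (Tᶜ ∩ E)).Reachable s r))
    (hb : (openGraph (Tᶜ ∩ E)).Reachable s r) : r ∉ beta E s k₀ R T := by
  rintro (h | ⟨-, h, -⟩)
  · exact hD ⟨h, hb⟩
  · exact h hb

/-- Colour of an unreached vertex. [this work] -/
theorem beta_iff_of_none (hr : ¬ (openGraph (T ∩ E)).Reachable s r) (hb : ¬ (openGraph (Tᶜ ∩ E)).Reachable s r) :
    r ∈ beta E s k₀ R T ↔ (T ∈ swSet E s k₀ R ↔ s(s, k₀) ∈ T) := by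
  simp only [beta, Set.mem_setOf_eq, hr, hb, false_or, not_false_eq_true, true_and]

/-- The source lies in no zone. [this work] -/
theorem source_not_mem_zone (hk : k₀ ≠ s) (huniv : ∀ v, v ≠ k₀ → s(k₀, v) ∈ E)
    (hD : ¬ ((openGraph (T ∩ E)).Reachable s r ∧ (openGraph (Tᶜ ∩ E)).Reachable s r)) : s ∉ zone E s k₀ R T r := by
  have hrs := ACone.ne_source_of_constraint hD
  rintro (h | ⟨hr, h⟩ | ⟨hb, h⟩ | ⟨hr, hb, -, h⟩ | ⟨hr, hb, -, h⟩)
  · exact hrs h.symm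
  · exact hD ⟨hr, (show (openGraph (Tᶜ ∩ E)).Reachable r s from h).symm⟩
  · exact hD ⟨(show (openGraph (T ∩ E)).Reachable r s from h).symm, hb⟩
  · obtain ⟨hn1, hn2⟩ := hub_not_reached hk huniv hr hb
    by_cases hsT : s(s, k₀) ∈ T
    · rw [hub_of_red hsT] at h
      exact hn1 hsT (show (openGraph (Tᶜ ∩ E)).Reachable k₀ s from h).symm
    · rw [hub_of_blue hsT] at h
      exact hn2 hsT (show (openGraph (T ∩ E)).Reachable k₀ s from h).symm
  · by_cases hsT : s(s, k₀) ∈ T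
    · rw [own_of_red hsT] at h
      exact hr (show (openGraph (T ∩ E)).Reachable r s from h).symm
    · rw [own_of_blue hsT] at h
      exact hb (show (openGraph (Tᶜ ∩ E)).Reachable r s from h).symm

/-- **Boundary property**: every edge of `E` from outside the zone of `r` into it has the zone's colour. [this work] -/
theorem boundary (hk : k₀ ≠ s) (huniv : ∀ v, v ≠ k₀ → s(k₀, v) ∈ E)
    (hD : ¬ ((openGraph (T ∩ E)).Reachable s r ∧ (openGraph (Tᶜ ∩ E)).Reachable s r))
    {x y : V} (hx : x ∉ zone E s k₀ R T r) (hy : y ∈ zone E s k₀ R T r) (hxy : s(x, y) ∈ E) :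
    (s(x, y) ∈ T ↔ r ∈ beta E s k₀ R T) := by
  by_cases hr : (openGraph (T ∩ E)).Reachable s r
  · rw [zone_of_red hD hr] at hx hy
    have h := not_mem_of_boundary (Tᶜ ∩ E) r hx hy
    exact iff_of_true (by_contra fun h' => h ⟨h', hxy⟩) (beta_of_red hr)
  · by_cases hb : (openGraph (Tᶜ ∩ E)).Reachable s r
    · rw [zone_of_blue hD hb] at hx hy
      have h := not_mem_of_boundary (T ∩ E) r hx hy
      exact iff_of_false (fun h' => h ⟨h', hxy⟩) (not_beta_of_blue hD hb)
    · rw [beta_iff_of_none hr hb]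
      by_cases hsw : T ∈ swSet E s k₀ R
      · rw [zone_of_sw hk huniv hr hb hsw] at hx hy
        by_cases hsT : s(s, k₀) ∈ T
        · rw [hub_of_red hsT] at hx hy
          have h := not_mem_of_boundary (Tᶜ ∩ E) k₀ hx hy
          exact iff_of_true (by_contra fun h' => h ⟨h', hxy⟩) (iff_of_true hsw hsT)
        · rw [hub_of_blue hsT] at hx hy
          have h := not_mem_of_boundary (T ∩ E) k₀ hx hy
          exact iff_of_false (fun h' => h ⟨h', hxy⟩) (fun h' => hsT (h'.1 hsw))
      · rw [zone_of_small hr hb hsw] at hx hy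
        by_cases hsT : s(s, k₀) ∈ T
        · rw [own_of_red hsT] at hx hy
          have h := not_mem_of_boundary (T ∩ E) r hx hy
          exact iff_of_false (fun h' => h ⟨h', hxy⟩) (fun h' => hsw (h'.2 hsT))
        · rw [own_of_blue hsT] at hx hy
          have h := not_mem_of_boundary (Tᶜ ∩ E) r hx hy
          exact iff_of_true (by_contra fun h' => h ⟨h', hxy⟩) (iff_of_false hsw hsT)

end NormalForms



end UCone

end Antithetic

end Summit.CriticalPhenomena.PercolationContinuityZ3.Theorems
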